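import Literature.AnabelianGeometry.AbsoluteAnabelian.HolomorphicEllipticCuspidalizationOfUniformization
import Literature.Geometry.Kaehler.RiemannSurfaceGenusOneUniformization
import HarnessLib

/-!
# [AbsTopIII] Cor 2.7 (c).3: `GenusOneUniformization` REDUCED to the existence of a nowhere-vanishing
# holomorphic differential (the developing-map half of genus-one uniformization is proved)

Proof-only file (theorems only) for the sub-DAG of [AbsTopIII] Corollary 2.7 (a)(b)(c)(e)
(S. Mochizuki, *Topics in absolute anabelian geometry III*, kurims pp. 58–60, lit key
`paper:url-5493eb38cbb7`; statements `HolomorphicEllipticCuspidalization.lean` p414370; final assembly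
`HolomorphicEllipticCuspidalizationOfUniformization.lean` p417157; table
`plan/L4/SUBDAG-AbsTopIII-Cor-27.md`).  The ONE classical input of the kernel reduction of the named
fact of Cor 2.7 (c), sub-node (c).3

  `GenusOneUniformization` = «a compact connected Riemann surface homeomorphic to a torus is
  biholomorphic to a complex torus `ℂ/Φ(ℤ²)`» (Farkas–Kra, *Riemann Surfaces*, III.6.3–III.6.4 /
  IV.6.1 (c); abc-iut GAP-LEDGER G-L4t12g4-1),

splits classically into (A) «such a surface carries a holomorphic differential with no zeros»
(analytic: `g = 1` and the canonical class is trivial — Riemann–Roch / Serre duality) and (B) «a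
compact Riemann surface homeomorphic to a torus with a nowhere-vanishing holomorphic differential is
biholomorphic to the torus `ℂ/G` of its periods» (the developing map / Abel–Jacobi map, Farkas–Kra
III.6.4).  Half (B) is now a tree THEOREM
(`Literature.Geometry.Kaehler.RiemannSurface.MeromorphicOneForm.exists_biholomorphic_complexTorus_of_oneForm'`,
files `RiemannSurfaceOneFormPrimitives` / `…Development` / `…GenusOnePeriods` / `…GenusOneDescent` /
`…GenusOneUniformization`), so the residual classical input of Cor 2.7 (c) shrinks to (A), stated
below as an explicit hypothesis (NOT a new named fact):

* `genusOneUniformization_of_forall_exists_oneForm` —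
  `(∀ T …torus-like…, ∃ ω holomorphic with ord_p ω = 0 ∀ p) → GenusOneUniformization`;
* `torsionPointsDenseUniqueGroupLaw_of_forall_exists_oneForm` — hence the named fact
  `TorsionPointsDenseUniqueGroupLaw` of Cor 2.7 (c) from hypothesis (A) alone (composition with
  p417157's `torsionPointsDenseUniqueGroupLaw_of_genusOneUniformization`).

HONEST FRAMING: OUR kernel check of a statement of a refereed paper modulo an explicitly stated
classical hypothesis; nothing here bears on the disputed [IUTchIII] Cor. 3.12.
-/

namespace Literature.AnabelianGeometry.AbsoluteAnabelian

open scoped _root_.Manifold _root_.ContDiff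
open Literature.Geometry.Kaehler
open Literature.Geometry.Kaehler.RiemannSurface

namespace HolomorphicEllipticCuspidalization

/-- **Sub-node (c).3 reduced to its analytic half.**  If every compact connected Riemann surface
homeomorphic to `S¹ × S¹` carries a holomorphic `1`-form `ω` (tree carrier `MeromorphicOneForm`,
`IsHolomorphic`) with `ord_p ω = 0` at every point (Farkas–Kra III.6.3: the holomorphic differential of
a surface of genus one has no zeros), then `GenusOneUniformization` holds — by the developing-map
theorem `exists_biholomorphic_complexTorus_of_oneForm'` (Farkas–Kra III.6.4), proved in the tree.
[cite: FarkasKra1992, III.6.4] -/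
theorem genusOneUniformization_of_forall_exists_oneForm
    (hA : ∀ (T : Type) [TopologicalSpace T] [T2Space T] [CompactSpace T] [ConnectedSpace T]
      [ChartedSpace ℂ T] [IsManifold 𝓘(ℂ, ℂ) ω T],
      Nonempty (T ≃ₜ AddCircle (1 : ℝ) × AddCircle (1 : ℝ)) →
        ∃ η : MeromorphicOneForm T, η.IsHolomorphic ∧ ∀ p, η.meromorphicOrderAt p = 0) :
    GenusOneUniformization := by
  intro T _ _ _ _ _ _ hT
  obtain ⟨e₀⟩ := hT
  obtain ⟨η, hη, hord⟩ := hA T ⟨e₀⟩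
  exact MeromorphicOneForm.exists_biholomorphic_complexTorus_of_oneForm' T e₀ η hη hord

/-- **[AbsTopIII] Cor 2.7 (c) modulo the analytic half only**: the named fact
`TorsionPointsDenseUniqueGroupLaw` (density of the cuspidal torsion points and uniqueness of the
topological group law on the one-point compactification of a punctured elliptic curve in the typed
conformal sense) follows from hypothesis (A) — existence of a nowhere-vanishing holomorphic
differential on every compact Riemann surface homeomorphic to a torus — via
`genusOneUniformization_of_forall_exists_oneForm` and p417157.
[cite: MochizukiAbsTopIII2015, Corollary 2.7 (c) p.59] -/
theorem torsionPointsDenseUniqueGroupLaw_of_forall_exists_oneForm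
    (hA : ∀ (T : Type) [TopologicalSpace T] [T2Space T] [CompactSpace T] [ConnectedSpace T]
      [ChartedSpace ℂ T] [IsManifold 𝓘(ℂ, ℂ) ω T],
      Nonempty (T ≃ₜ AddCircle (1 : ℝ) × AddCircle (1 : ℝ)) →
        ∃ η : MeromorphicOneForm T, η.IsHolomorphic ∧ ∀ p, η.meromorphicOrderAt p = 0) :
    Literature.AnabelianGeometry.AbsoluteAnabelian.TorsionPointsDenseUniqueGroupLaw :=
  torsionPointsDenseUniqueGroupLaw_of_genusOneUniformization
    (genusOneUniformization_of_forall_exists_oneForm hA)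

end HolomorphicEllipticCuspidalization

end Literature.AnabelianGeometry.AbsoluteAnabelian
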